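import Mathlib
import Summits.ValiantsHypothesis.ValiantsHypothesis.Theses.BarrierLever
import Summits.ValiantsHypothesis.ValiantsHypothesis.Theorems.BarrierLeverDefinableEquationsRungOneEquation
import Summits.ValiantsHypothesis.ValiantsHypothesis.Theorems.BarrierLeverDefinableEquationsLinearSizeDegree
import HarnessLib

/-!
# The first rung of `BarrierLever.DefinableEquations`: circuits of size ≤ n (b ≤ 1)

Route `BarrierLever`, crux `DefinableEquations` (stmt-ValiantsHypothesis-8745), line `registered`,
lead c3 — registered sub-goal `definableEquations_rungOne`.

The crux asks for ONE level `a` such that for EVERY size exponent `b`, eventually in `n`, a nonzero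
level-`a` boolean sum in the `N = C(2n,n)` coefficient variables vanishes at `coeff(f)` for every
`f ∈ SmallCircuits ℂ n b` (degree `≤ n`, fan-in-two size `≤ n^b`).  This file settles its first
rung: for every `b ≤ 1` (circuits of size `≤ n`) the inner statement holds with `(q, a) = (0, 1)`
from `n₀ = 3` on, composing
* the structure theorem `exists_degreeOf_le_two_of_complexity_le` (file `…LinearSizeDegree`): a
  polynomial of complexity `≤ n` in `n ≥ 1` variables has a variable of individual degree `≤ 2`
  (slot counting on the useful sub-DAG of an economical circuit: read-once plus one defect), and
* the equation `rungOne_of_exists_degreeOf_le_two` (file `…RungOneEquation`): hence the monomial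
  `E_n = ∏_j c_{x_j^3}` (size `≤ n ≤ N`, degree `n ≤ N`, `q = 0`) is a nonzero boolean sum
  vanishing on `coeff(SmallCircuits ℂ n b)`, `b ≤ 1`.
Corollaries: the `b ≤ 1` instances of the support item `SingleSizeEquations` and the `b ≤ 1`
truncation of `DefinableEquations` itself (one level `a = 1` serving both `b = 0` and `b = 1`).
The rung dies at `b = 2`, where `(x_1 + ⋯ + x_n)^3` (size `n + 1 ≤ n^2`) has every individual
degree `3`; the crux's open content (`stub_polyShortTableauEquation`, Chatterjee–Tengse 2023 §1.3
open direction 2) begins there.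
-/

set_option linter.dupNamespace false

noncomputable section

namespace Summit.ValiantsHypothesis.ValiantsHypothesis.Theorems.BarrierLeverDefinableEquations

open Literature.Computability.AlgebraicComplexity Literature.Barriers.ValiantsHypothesis MvPolynomial
open Summit.ValiantsHypothesis.ValiantsHypothesis.Theses.BarrierLever

/-- **Registered sub-goal `definableEquations_rungOne`** (crux stmt-ValiantsHypothesis-8745, line
`registered`, lead c3): the FIRST RUNG of `BarrierLever.DefinableEquations` — for every `b ≤ 1`,
eventually in `n`, a nonzero level-one boolean sum (`q ≤ N`, `L(H), deg H ≤ N`, `N = C(2n,n)`)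
in the coefficient variables vanishes at `coeff(f)` for every `f ∈ SmallCircuits ℂ n b`.
[folklore] -/
theorem definableEquations_rungOne :
    ∃ n₀ : ℕ, ∀ n ≥ n₀, ∀ b ≤ 1, ∃ q : ℕ, q ≤ (Nat.choose (2 * n) n) ^ 1 ∧
      ∃ H : MvPolynomial (↥(Literature.Barriers.ValiantsHypothesis.degLEMonomials n) ⊕ Fin q) ℂ,
        Literature.Computability.AlgebraicComplexity.complexity H ≤ (Nat.choose (2 * n) n) ^ 1 ∧
          H.totalDegree ≤ (Nat.choose (2 * n) n) ^ 1 ∧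
            Literature.Computability.AlgebraicComplexity.boolSum H ≠ 0 ∧
              ∀ f ∈ Literature.Barriers.ValiantsHypothesis.SmallCircuits ℂ n b, MvPolynomial.eval
                (Literature.Barriers.ValiantsHypothesis.coeffVector
                  (Literature.Barriers.ValiantsHypothesis.degLEMonomials n) f)
                (Literature.Computability.AlgebraicComplexity.boolSum H) = 0 :=
  rungOne_of_exists_degreeOf_le_two exists_degreeOf_le_two_of_complexity_le

/-- **`SingleSizeEquations` holds at every `b ≤ 1`** (level `a = 1`): the `b ≤ 1` instances of the
route's support item `BarrierLever.SingleSizeEquations`, unconditionally. [folklore] -/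
theorem singleSizeEquations_of_le_one :
    ∀ b ≤ 1, ∃ a n₀ : ℕ, ∀ n ≥ n₀, ∃ q : ℕ, q ≤ (Nat.choose (2 * n) n) ^ a ∧
      ∃ H : MvPolynomial (↥(degLEMonomials n) ⊕ Fin q) ℂ,
        complexity H ≤ (Nat.choose (2 * n) n) ^ a ∧ H.totalDegree ≤ (Nat.choose (2 * n) n) ^ a ∧
          boolSum H ≠ 0 ∧
            ∀ f ∈ SmallCircuits ℂ n b, eval (coeffVector (degLEMonomials n) f) (boolSum H) = 0 := by
  obtain ⟨n₀, hn₀⟩ := definableEquations_rungOne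
  intro b hb
  exact ⟨1, n₀, fun n hn => hn₀ n hn b hb⟩

/-- **The `b ≤ 1` truncation of the crux**: ONE level (`a = 1`) serves both size exponents
`b = 0` and `b = 1` — `DefinableEquations` with `∀ b` replaced by `∀ b ≤ 1`. [folklore] -/
theorem definableEquations_truncated_le_one :
    ∃ a : ℕ, ∀ b ≤ 1, ∃ n₀ : ℕ, ∀ n ≥ n₀, ∃ q : ℕ, q ≤ (Nat.choose (2 * n) n) ^ a ∧
      ∃ H : MvPolynomial (↥(degLEMonomials n) ⊕ Fin q) ℂ,
        complexity H ≤ (Nat.choose (2 * n) n) ^ a ∧ H.totalDegree ≤ (Nat.choose (2 * n) n) ^ a ∧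
          boolSum H ≠ 0 ∧
            ∀ f ∈ SmallCircuits ℂ n b, eval (coeffVector (degLEMonomials n) f) (boolSum H) = 0 := by
  obtain ⟨n₀, hn₀⟩ := definableEquations_rungOne
  exact ⟨1, fun b hb => ⟨n₀, fun n hn => hn₀ n hn b hb⟩⟩

/-- **Reduction of the crux to `b ≥ 2`**: `DefinableEquations` follows from its restriction to
size exponents `b ≥ 2` at any level `a ≥ 1` (the rung supplies `b ≤ 1` at level `1 ≤ a`, and
levels are monotone since `N ≥ 1`). [folklore] -/
theorem definableEquations_of_ge_two
    (h : ∃ a : ℕ, 1 ≤ a ∧ ∀ b : ℕ, 2 ≤ b → ∃ n₀ : ℕ, ∀ n ≥ n₀, ∃ q : ℕ,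
      q ≤ (Nat.choose (2 * n) n) ^ a ∧ ∃ H : MvPolynomial (↥(degLEMonomials n) ⊕ Fin q) ℂ,
        complexity H ≤ (Nat.choose (2 * n) n) ^ a ∧ H.totalDegree ≤ (Nat.choose (2 * n) n) ^ a ∧
          boolSum H ≠ 0 ∧
            ∀ f ∈ SmallCircuits ℂ n b, eval (coeffVector (degLEMonomials n) f) (boolSum H) = 0) :
    DefinableEquations := by
  obtain ⟨a, ha, hge⟩ := h
  obtain ⟨n₁, hn₁⟩ := definableEquations_rungOne
  refine ⟨a, fun b => ?_⟩
  by_cases hb : 2 ≤ b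
  · exact hge b hb
  · refine ⟨n₁, fun n hn => ?_⟩
    obtain ⟨q, hq, H, hH, hdeg, hne, hvan⟩ := hn₁ n hn b (by omega)
    have hN : 0 < Nat.choose (2 * n) n := Nat.choose_pos (by omega)
    have hmono : (Nat.choose (2 * n) n) ^ 1 ≤ (Nat.choose (2 * n) n) ^ a :=
      Nat.pow_le_pow_right hN ha
    exact ⟨q, hq.trans hmono, H, hH.trans hmono, hdeg.trans hmono, hne, hvan⟩

/-- **A little beyond the rung**: against circuits of size `≤ n + t` with `2^(t+1) < n` (size up to
`n + log₂ n - 2`), the monomial `∏_j c_{x_j^n}` is still an equation — some variable has individual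
degree `≤ 2^(t+1) < n`, so its pure power `x_j^n` has coefficient `0`. [folklore] -/
theorem exists_coeff_single_self_eq_zero_of_complexity_le_add {n t : ℕ} (ht : 2 ^ (t + 1) < n)
    (f : MvPolynomial (Fin n) ℂ) (hf : complexity f ≤ n + t) :
    ∃ j : Fin n, coeff (Finsupp.single j n) f = 0 := by
  obtain ⟨j, hj⟩ := exists_degreeOf_le_two_pow_of_complexity_le
    (le_of_lt (lt_of_le_of_lt Nat.one_le_two_pow ht)) t f hf
  refine ⟨j, ?_⟩
  by_contra hne
  have hmem : Finsupp.single j n ∈ f.support := by simpa [MvPolynomial.mem_support_iff] using hne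
  have hle : (Finsupp.single j n) j ≤ f.degreeOf j :=
    (MvPolynomial.degreeOf_le_iff.1 le_rfl) _ hmem
  rw [Finsupp.single_eq_same] at hle
  omega

end Summit.ValiantsHypothesis.ValiantsHypothesis.Theorems.BarrierLeverDefinableEquations

end
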